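import Summits.QuantumFields.YangMills.Theorems.NPointIsotropy.Negative.TieLoadBearing
import Summits.QuantumFields.YangMills.Theorems.CurvatureBoostCovariance.Negative.Unbundled
import Literature.MathematicalPhysics.QuantumFieldTheory.OSLorentzInvariance

/-!
# `NPointIsotropy`, line quarter-turn-corner-operator — stub D bookkeeping: the corner form is a diagonal-frame Gram form

Support lemmas for the lead's stub `stub_eighthTurnIdentity` (crux stmt-QuantumFields-11686, item evidence
`work/D_analysis.md` §1, §3): planar rotations versus the OS adjoint and the appended tensor product, and the
test-function identity behind the corner transfer operator,
`ΘG₁* ⊗ Rq·G₂ = R₈·(Θ(R₈·G₁)* ⊗ R₈·G₂)` (`Rq` the quarter-turn `e₀ ↦ e₁`, `R₈` the eighth-turn, `R₈² = Rq`),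
which exhibits the corner form `⟨[G₁],[Rq·G₂]⟩_{e₀}` as the Gram pairing of `R₈·G₁, R₈·G₂` in the diagonal frame
`R₈` (one of the eight planar frames). [folklore]
-/

noncomputable section

namespace Summit.QuantumFields.YangMills.Theorems.NPointIsotropy.QuarterTurnCornerOperator

namespace Corner

open scoped SchwartzMap
open Literature.MathematicalPhysics.QuantumLattice Literature.MathematicalPhysics.AQFT
  Literature.MathematicalPhysics.QuantumFieldTheory
open Summit.QuantumFields.YangMills.Theorems.NPointIsotropy.Negative (E4)

variable {n m : ℕ}


/-- Composition of planar rotations adds the angles (pointwise). [folklore] -/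
theorem rot_rot_apply (a b : ℝ) (x : E4) : planeRot (d := 3) 0 a (planeRot (d := 3) 0 b x) = planeRot (d := 3) 0 (a + b) x := by
  ext j
  fin_cases j <;> simp [planeRot_apply, Real.cos_add, Real.sin_add] <;> ring

/-- `rot 0` is the identity (pointwise). [folklore] -/
theorem rot_zero_apply (x : E4) : planeRot (d := 3) 0 0 x = x := planeRot_zero_apply 0 x

/-- The inverse of `rot φ` is `rot (-φ)` (pointwise). [folklore] -/
theorem rot_symm_apply (φ : ℝ) (x : E4) : (planeRot (d := 3) 0 φ).symm x = planeRot (d := 3) 0 (-φ) x := by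
  apply (planeRot (d := 3) 0 φ).injective
  rw [LinearIsometryEquiv.apply_symm_apply, rot_rot_apply, add_neg_cancel, rot_zero_apply]

/-- Time reflection conjugates a planar rotation to its inverse: `θ (rot φ x) = rot (-φ) (θ x)`. [folklore] -/
theorem timeReflection_rot (φ : ℝ) (x : E4) :
    timeReflection 4 (planeRot (d := 3) 0 φ x) = planeRot (d := 3) 0 (-φ) (timeReflection 4 x) := by
  ext j
  fin_cases j <;> (simp [timeReflection_apply, planeRot_apply]; try ring)

/-- Iterated linear actions compose: `L·(L'·F) = (L' ≫ L)·F`. [folklore] -/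
theorem linActMulti_linActMulti (L L' : E4 ≃ₗᵢ[ℝ] E4) (F : 𝓢((Fin n → E4), ℂ)) :
    linActMulti L (linActMulti L' F) = linActMulti (L'.trans L) F := by
  ext x
  simp only [linActMulti_apply]
  rfl

/-- `rot a · (rot b · F) = rot (a + b) · F`. [folklore] -/
theorem linActMulti_rot_rot (a b : ℝ) (F : 𝓢((Fin n → E4), ℂ)) :
    linActMulti (planeRot (d := 3) 0 a) (linActMulti (planeRot (d := 3) 0 b) F) = linActMulti (planeRot (d := 3) 0 (a + b)) F := by
  ext x
  simp only [linActMulti_apply, rot_symm_apply]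
  congr 1
  funext i
  rw [rot_rot_apply]
  ring_nf

/-- `rot 0 · F = F`. [folklore] -/
theorem linActMulti_rot_zero (F : 𝓢((Fin n → E4), ℂ)) : linActMulti (planeRot (d := 3) 0 0) F = F := by
  ext x
  simp only [linActMulti_apply, rot_symm_apply, neg_zero, rot_zero_apply]

/-- The diagonal linear action distributes over the appended tensor product. [folklore] -/
theorem linActMulti_appendTensor (L : E4 ≃ₗᵢ[ℝ] E4) (A : 𝓢((Fin n → E4), ℂ)) (B : 𝓢((Fin m → E4), ℂ)) :
    linActMulti L (A.appendTensor B) = (linActMulti L A).appendTensor (linActMulti L B) := by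
  ext x
  simp only [linActMulti_apply, SchwartzMap.appendTensor_apply]
  rfl

/-- **OS adjoint versus planar rotations**: `Θ(rot φ · G)* = rot (-φ) · (ΘG*)` (time reflection inverts the
rotation of the `(x₀,x₁)`-plane). [folklore] -/
theorem osAdjoint_linActMulti_rot (φ : ℝ) (G : 𝓢((Fin n → E4), ℂ)) :
    osAdjoint (linActMulti (planeRot (d := 3) 0 φ) G) = linActMulti (planeRot (d := 3) 0 (-φ)) (osAdjoint G) := by
  ext x
  simp only [osAdjoint_apply, linActMulti_apply, rot_symm_apply, neg_neg]
  congr 3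
  funext i
  rw [timeReflection_rot]

/-- **The corner identity** (D0a): for the quarter-turn `Rq = rot (-π/2)` (`e₀ ↦ e₁`) and the eighth-turn
`R₈ = rot (-π/4)`, `ΘG₁* ⊗ Rq·G₂ = R₈·(Θ(R₈·G₁)* ⊗ R₈·G₂)`: the corner pairing is the pairing of the eighth-turned
test functions, rotated into the diagonal frame `R₈`. [folklore] -/
theorem corner_identity (G₁ : 𝓢((Fin n → E4), ℂ)) (G₂ : 𝓢((Fin m → E4), ℂ)) :
    (osAdjoint G₁).appendTensor (linActMulti (planeRot (d := 3) 0 (-(Real.pi / 2))) G₂) =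
      linActMulti (planeRot (d := 3) 0 (-(Real.pi / 4)))
        ((osAdjoint (linActMulti (planeRot (d := 3) 0 (-(Real.pi / 4))) G₁)).appendTensor
          (linActMulti (planeRot (d := 3) 0 (-(Real.pi / 4))) G₂)) := by
  rw [linActMulti_appendTensor, osAdjoint_linActMulti_rot, linActMulti_rot_rot, linActMulti_rot_rot]
  have h1 : -(Real.pi / 4) + - -(Real.pi / 4) = 0 := by ring
  have h2 : -(Real.pi / 4) + -(Real.pi / 4) = -(Real.pi / 2) := by ring
  rw [h1, h2, linActMulti_rot_zero]

/-- **The sector identity** (D0a'): `Θ(R₈·G₁)* ⊗ R₈·G₂ = R₈⁻¹·(ΘG₁* ⊗ Rq·G₂)`, i.e. the eighth-turned Gram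
configuration is the corner-split configuration rotated by `-π/4` (here `R₈⁻¹ = rot (π/4)`). [folklore] -/
theorem sector_identity (G₁ : 𝓢((Fin n → E4), ℂ)) (G₂ : 𝓢((Fin m → E4), ℂ)) :
    (osAdjoint (linActMulti (planeRot (d := 3) 0 (-(Real.pi / 4))) G₁)).appendTensor (linActMulti (planeRot (d := 3) 0 (-(Real.pi / 4))) G₂) =
      linActMulti (planeRot (d := 3) 0 (Real.pi / 4))
        ((osAdjoint G₁).appendTensor (linActMulti (planeRot (d := 3) 0 (-(Real.pi / 2))) G₂)) := by
  rw [corner_identity, linActMulti_rot_rot]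
  have h : Real.pi / 4 + -(Real.pi / 4) = 0 := by ring
  rw [h, linActMulti_rot_zero]

end Corner

end Summit.QuantumFields.YangMills.Theorems.NPointIsotropy.QuarterTurnCornerOperator

namespace Summit.QuantumFields.YangMills.Theorems.NPointIsotropy.QuarterTurnCornerOperator

namespace Corner

open scoped BigOperators SchwartzMap
open Literature.MathematicalPhysics.QuantumLattice Literature.MathematicalPhysics.AQFT
  Literature.MathematicalPhysics.QuantumFieldTheory
open Summit.QuantumFields.YangMills.Theorems.NPointIsotropy.Negative (E4)
open Summit.QuantumFields.YangMills.Theorems.CurvatureBoostCovariance.Negative (isOffDiagonal_linActMulti)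

variable {n : ℕ}

/-- The eighth-turn `rot (-π/4)` maps `e₀` to `(e₀ + e₁)/√2`: it is the diagonal frame of `EightFrameRP` with
`a = b = √2/2`. [folklore] -/
theorem rot_eighth_single_zero :
    planeRot (d := 3) 0 (-(Real.pi / 4)) (EuclideanSpace.single 0 1) =
      (Real.sqrt 2 / 2) • EuclideanSpace.single 0 1 + (Real.sqrt 2 / 2) • EuclideanSpace.single 1 1 := by
  have hc : Real.cos (-(Real.pi / 4)) = Real.sqrt 2 / 2 := by rw [Real.cos_neg, Real.cos_pi_div_four]
  have hs : Real.sin (-(Real.pi / 4)) = -(Real.sqrt 2 / 2) := by rw [Real.sin_neg, Real.sin_pi_div_four]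
  ext j
  fin_cases j <;> simp [planeRot_apply, hc, hs]

/-- `(√2/2)² + (√2/2)² = 1`. [folklore] -/
theorem sqrt_two_half_sq_add : (Real.sqrt 2 / 2) ^ 2 + (Real.sqrt 2 / 2) ^ 2 = 1 := by
  rw [div_pow, Real.sq_sqrt two_pos.le]; norm_num

/-- A point of the support of `L·F` comes from a point of the support of `F`: if `x ∈ tsupport (L·F)` then
`(L⁻¹ xᵢ)ᵢ ∈ tsupport F`. [folklore] -/
theorem mem_tsupport_of_mem_tsupport_linActMulti (L : E4 ≃ₗᵢ[ℝ] E4) (F : 𝓢((Fin n → E4), ℂ))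
    {x : Fin n → E4} (hx : x ∈ tsupport ((linActMulti L F : 𝓢((Fin n → E4), ℂ)) : (Fin n → E4) → ℂ)) :
    (fun i => L.symm (x i)) ∈ tsupport (F : (Fin n → E4) → ℂ) := by
  set Φ : (Fin n → E4) → (Fin n → E4) := fun x i => L.symm (x i) with hΦ
  have hcont : Continuous Φ := continuous_pi fun i => L.symm.continuous.comp (continuous_apply i)
  have hfun : ((linActMulti L F : 𝓢((Fin n → E4), ℂ)) : (Fin n → E4) → ℂ) = (F : (Fin n → E4) → ℂ) ∘ Φ := by
    funext y; rfl
  rw [hfun] at hx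
  exact (tsupport_comp_subset_preimage (F : (Fin n → E4) → ℂ) hcont) hx

/-- The eighth-turn maps the quadrant `Q = {x⁰ > 0 > x¹}` into the open half-space `{x⁰ > 0}`; hence a
quadrant-supported test function becomes positive-time. [folklore] -/
theorem isPositiveTimeMulti_linActMulti_eighth (F : 𝓢((Fin n → E4), ℂ))
    (hF : tsupport (F : (Fin n → E4) → ℂ) ⊆ {x | ∀ i, 0 < x i 0 ∧ x i 1 < 0}) :
    IsPositiveTimeMulti (linActMulti (planeRot (d := 3) 0 (-(Real.pi / 4))) F) := by
  intro x hx i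
  have hy := hF (mem_tsupport_of_mem_tsupport_linActMulti _ F hx) i
  rw [rot_symm_apply, neg_neg] at hy
  obtain ⟨h0, h1⟩ := hy
  have hc : Real.cos (Real.pi / 4) = Real.sqrt 2 / 2 := Real.cos_pi_div_four
  have hs : Real.sin (Real.pi / 4) = Real.sqrt 2 / 2 := Real.sin_pi_div_four
  simp only [planeRot_apply, Fin.succ_zero_eq_one, hc, hs, if_true, one_ne_zero, if_false] at h0 h1
  have hpos : 0 < Real.sqrt 2 / 2 := by positivity
  nlinarith

/-- **Corner positivity (D0b)** — the first lemma of the card: with UNORDERED reflection positivity in the eight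
planar frames, the corner form `(G₁,G₂) ↦ 𝔖(ΘG₁* ⊗ Rq·G₂)` (`Rq = rot (-π/2)`, the quarter-turn `e₀ ↦ e₁`) is
positive semi-definite on quadrant-supported off-diagonal test functions: `P : [G] ↦ [Rq·G]` is a positive operator
on quadrant vectors of the `e₀`-OS space. Proof: the corner identity moves each pairing into the diagonal frame
`R₈ = rot (-π/4)`, where it is the OS Gram pairing of the positive-time family `R₈·Gₙ`. [folklore] -/
theorem corner_form_nonneg :
    open Literature.MathematicalPhysics.QuantumLattice Literature.MathematicalPhysics.AQFT
      Literature.MathematicalPhysics.QuantumFieldTheory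
      Summit.QuantumFields.YangMills.Theorems.NPointIsotropy.Negative in
    ∀ (S₁ : SchwingerFamily E4),
    (∀ (R : E4 ≃ₗᵢ[ℝ] E4) (a b : ℝ), a ^ 2 + b ^ 2 = 1 → (a = 0 ∨ b = 0 ∨ a ^ 2 = b ^ 2) →
      R (EuclideanSpace.single 0 1) = a • EuclideanSpace.single 0 1 + b • EuclideanSpace.single 1 1 →
      ∀ (N : ℕ) (F : (n : ℕ) → SchwartzMap (Fin n → E4) ℂ),
        (∀ n, N < n → F n = 0) → (∀ n, IsPositiveTimeMulti (F n)) → (∀ n, IsOffDiagonal (F n)) →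
        ∀ H : (n m : ℕ) → SchwartzMap (Fin (n + m) → E4) ℂ,
          (∀ n m, IsAppendTensorOf (H n m) (osAdjoint (F n)) (F m)) →
          0 ≤ (∑ n ∈ Finset.range (N + 1), ∑ m ∈ Finset.range (N + 1),
              (S₁ (n + m)).comp (linActMulti R) (H n m)).re ∧
            (∑ n ∈ Finset.range (N + 1), ∑ m ∈ Finset.range (N + 1),
              (S₁ (n + m)).comp (linActMulti R) (H n m)).im = 0) →
    ∀ (N : ℕ) (G : (n : ℕ) → SchwartzMap (Fin n → E4) ℂ), (∀ n, N < n → G n = 0) →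
    (∀ n, tsupport (G n : (Fin n → E4) → ℂ) ⊆ {x | ∀ i, 0 < x i 0 ∧ x i 1 < 0}) →
    (∀ n, IsOffDiagonal (G n)) →
    0 ≤ (∑ n ∈ Finset.range (N + 1), ∑ m ∈ Finset.range (N + 1),
        S₁ (n + m) ((osAdjoint (G n)).appendTensor
          (linActMulti (planeRot (d := 3) 0 (-(Real.pi / 2))) (G m)))).re ∧
      (∑ n ∈ Finset.range (N + 1), ∑ m ∈ Finset.range (N + 1),
        S₁ (n + m) ((osAdjoint (G n)).appendTensor
          (linActMulti (planeRot (d := 3) 0 (-(Real.pi / 2))) (G m)))).im = 0 := by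
  intro S₁ hurp N G hGN hGQ hGoff
  set R₈ : E4 ≃ₗᵢ[ℝ] E4 := planeRot (d := 3) 0 (-(Real.pi / 4)) with hR₈
  set F : (n : ℕ) → SchwartzMap (Fin n → E4) ℂ := fun n => linActMulti R₈ (G n) with hF
  have key := hurp R₈ (Real.sqrt 2 / 2) (Real.sqrt 2 / 2) sqrt_two_half_sq_add (Or.inr (Or.inr rfl))
    rot_eighth_single_zero N F
    (fun n hn => by simp [hF, hGN n hn])
    (fun n => isPositiveTimeMulti_linActMulti_eighth (G n) (hGQ n))
    (fun n => isOffDiagonal_linActMulti (hGoff n) R₈)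
    (fun n m => (osAdjoint (F n)).appendTensor (F m))
    (fun n m => isAppendTensorOf_appendTensor _ _)
  have hterm : ∀ n m, (S₁ (n + m)).comp (linActMulti R₈) ((osAdjoint (F n)).appendTensor (F m)) =
      S₁ (n + m) ((osAdjoint (G n)).appendTensor (linActMulti (planeRot (d := 3) 0 (-(Real.pi / 2))) (G m))) := by
    intro n m
    rw [ContinuousLinearMap.comp_apply, hF, hR₈, ← corner_identity]
  simp only [hterm] at key
  exact key

end Corner

end Summit.QuantumFields.YangMills.Theorems.NPointIsotropy.QuarterTurnCornerOperator

end
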